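import Mathlib

/-!
# PF persistence, fake seat 1 — LEMMA F1-N core: a finite cosine sum vanishing near `0` is trivial (PROVED)

Unit `pub-rhpf-fake-1` of the `pub-rhpf` cell (mechanism / rigidity campaign; **no RH claims**);
companion of `HOME/FAKES.md §1.8.4`, LEMMA F1-N ('finite theft is impossible').  Nothing here mentions
`ζ`: this is the elementary closing step of F1-N.  In F1-N a real even finitely-atomic measure
`ν⁻ = Σ_{γ ∈ E} c_γ (δ_γ + δ_{−γ})` has cosine transform `x ↦ 2 Σ c_γ cos(γ x)` vanishing on the
spectral gap `(−L, L)`; the lemma below concludes `c_γ = 0` for all `γ`, i.e. `ν⁻ = 0`.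

Proof: all derivatives of `f(x) = Σ c_j cos(γ_j x)` vanish on the open interval; the even ones at `0`
give `Σ_j c_j (γ_j²)^m = 0` for every `m`, a Vandermonde system in the distinct nodes `γ_j²`.

* `cosSum`, `sinSum` — the sums `Σ c_j (γ_j²)^m cos(γ_j x)` and `Σ c_j (γ_j²)^m γ_j sin(γ_j x)`;
* `hasDerivAt_cosSum`, `hasDerivAt_sinSum` — the derivative ladder;
* `cosSum_coeff_eq_zero` — LEMMA F1-N core: vanishing on `(−L, L)` forces `c = 0`.
-/

set_option linter.dupNamespace false

noncomputable section

open Filter Topology Finset Matrix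

namespace Summit.RiemannHypothesis.RiemannHypothesis.Theorems.PfPersistence.Fake1.TrigSum

variable {n : ℕ}

/-- `cosSum γ c m x = Σ_j c_j (γ_j ^ 2) ^ m cos (γ_j x)`. -/
def cosSum (γ c : Fin n → ℝ) (m : ℕ) (x : ℝ) : ℝ :=
  ∑ j, c j * (γ j ^ 2) ^ m * Real.cos (γ j * x)

/-- `sinSum γ c m x = Σ_j c_j (γ_j ^ 2) ^ m γ_j sin (γ_j x)`. -/
def sinSum (γ c : Fin n → ℝ) (m : ℕ) (x : ℝ) : ℝ :=
  ∑ j, c j * (γ j ^ 2) ^ m * γ j * Real.sin (γ j * x)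

/-- Derivative ladder, even step: `(cosSum γ c m)' = -sinSum γ c m`. -/
theorem hasDerivAt_cosSum (γ c : Fin n → ℝ) (m : ℕ) (x : ℝ) :
    HasDerivAt (cosSum γ c m) (-(sinSum γ c m x)) x := by
  unfold cosSum sinSum
  rw [← Finset.sum_neg_distrib]
  refine HasDerivAt.fun_sum fun j _ => ?_
  have h1 : HasDerivAt (fun y : ℝ => γ j * y) (γ j) x := by
    have := ((hasDerivAt_id x).const_mul (γ j) : HasDerivAt (fun y : ℝ => γ j * id y) (γ j * 1) x)
    simpa using this
  have h2 : HasDerivAt (fun y : ℝ => Real.cos (γ j * y)) (-Real.sin (γ j * x) * γ j) x :=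
    (Real.hasDerivAt_cos (γ j * x)).comp x h1
  have h3 := h2.const_mul (c j * (γ j ^ 2) ^ m)
  refine h3.congr_deriv ?_
  ring

/-- Derivative ladder, odd step: `(sinSum γ c m)' = cosSum γ c (m + 1)`. -/
theorem hasDerivAt_sinSum (γ c : Fin n → ℝ) (m : ℕ) (x : ℝ) :
    HasDerivAt (sinSum γ c m) (cosSum γ c (m + 1) x) x := by
  unfold cosSum sinSum
  refine HasDerivAt.fun_sum fun j _ => ?_
  have h1 : HasDerivAt (fun y : ℝ => γ j * y) (γ j) x := by
    have := ((hasDerivAt_id x).const_mul (γ j) : HasDerivAt (fun y : ℝ => γ j * id y) (γ j * 1) x)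
    simpa using this
  have h2 : HasDerivAt (fun y : ℝ => Real.sin (γ j * y)) (Real.cos (γ j * x) * γ j) x :=
    (Real.hasDerivAt_sin (γ j * x)).comp x h1
  have h3 := h2.const_mul (c j * (γ j ^ 2) ^ m * γ j)
  refine h3.congr_deriv ?_
  ring

/-- If a function vanishes on an open set around `x` and has derivative `f'` at `x`, then `f' = 0`. -/
theorem deriv_val_eq_zero_of_eventually {f : ℝ → ℝ} {f' x : ℝ} (hf : HasDerivAt f f' x)
    (h0 : f =ᶠ[𝓝 x] fun _ => 0) : f' = 0 := by
  have h1 : deriv f x = f' := hf.deriv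
  have h2 : deriv f x = deriv (fun _ : ℝ => (0 : ℝ)) x := h0.deriv_eq
  rw [deriv_const] at h2
  rw [← h1, h2]

/-- On the open interval `(−L, L)`: if `cosSum γ c m` vanishes there, so do `sinSum γ c m` and
`cosSum γ c (m+1)`. -/
theorem ladder (γ c : Fin n → ℝ) (m : ℕ) {L : ℝ}
    (h : ∀ x ∈ Set.Ioo (-L) L, cosSum γ c m x = 0) :
    (∀ x ∈ Set.Ioo (-L) L, sinSum γ c m x = 0) ∧ (∀ x ∈ Set.Ioo (-L) L, cosSum γ c (m + 1) x = 0) := by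
  have hs : ∀ x ∈ Set.Ioo (-L) L, sinSum γ c m x = 0 := by
    intro x hx
    have hev : cosSum γ c m =ᶠ[𝓝 x] fun _ => 0 :=
      Filter.eventually_of_mem (isOpen_Ioo.mem_nhds hx) fun y hy => h y hy
    have := deriv_val_eq_zero_of_eventually (hasDerivAt_cosSum γ c m x) hev
    linarith
  refine ⟨hs, fun x hx => ?_⟩
  have hev : sinSum γ c m =ᶠ[𝓝 x] fun _ => 0 :=
    Filter.eventually_of_mem (isOpen_Ioo.mem_nhds hx) fun y hy => hs y hy
  exact deriv_val_eq_zero_of_eventually (hasDerivAt_sinSum γ c m x) hev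

/-- All even 'derivative sums' vanish at `0`: `Σ_j c_j (γ_j²)^m = 0` for every `m`. -/
theorem moment_eq_zero (γ c : Fin n → ℝ) {L : ℝ} (hL : 0 < L)
    (h : ∀ x ∈ Set.Ioo (-L) L, cosSum γ c 0 x = 0) (m : ℕ) :
    ∑ j, c j * (γ j ^ 2) ^ m = 0 := by
  have key : ∀ k, ∀ x ∈ Set.Ioo (-L) L, cosSum γ c k x = 0 := by
    intro k
    induction k with
    | zero => exact h
    | succ k ih => exact (ladder γ c k ih).2
  have h0 : (0 : ℝ) ∈ Set.Ioo (-L) L := ⟨by linarith, hL⟩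
  have := key m 0 h0
  simpa [cosSum] using this

/-- **LEMMA F1-N core** (FAKES §1.8.4; mechanism/rigidity campaign, no RH claims): if
`Σ_j c_j cos(γ_j x) = 0` for all `x ∈ (−L, L)` (`L > 0`) with distinct nonnegative frequencies
`γ_j`, then every coefficient `c_j` vanishes. -/
theorem cosSum_coeff_eq_zero (γ c : Fin n → ℝ) (hγ : Function.Injective γ) (hpos : ∀ j, 0 ≤ γ j)
    {L : ℝ} (hL : 0 < L) (h : ∀ x ∈ Set.Ioo (-L) L, ∑ j, c j * Real.cos (γ j * x) = 0) :
    c = 0 := by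
  -- distinct squares
  have hinj : Function.Injective fun j => γ j ^ 2 := by
    intro i j hij
    have hij' : γ i ^ 2 = γ j ^ 2 := by simpa using hij
    exact hγ ((pow_left_inj₀ (hpos i) (hpos j) (by norm_num : (2 : ℕ) ≠ 0)).1 hij')
  have hdet : (vandermonde fun j => γ j ^ 2).det ≠ 0 :=
    (det_vandermonde_ne_zero_iff).2 hinj
  have h' : ∀ x ∈ Set.Ioo (-L) L, cosSum γ c 0 x = 0 := by
    intro x hx
    simpa [cosSum] using h x hx
  have hvec : c ᵥ* (vandermonde fun j => γ j ^ 2) = 0 := by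
    funext m
    rw [vecMul, dotProduct]
    simp only [vandermonde_apply, Pi.zero_apply]
    exact moment_eq_zero γ c hL h' m
  exact eq_zero_of_vecMul_eq_zero hdet hvec

end Summit.RiemannHypothesis.RiemannHypothesis.Theorems.PfPersistence.Fake1.TrigSum
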